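import Mathlib

/-!
# `T4Continuum.Spine.NE7c.LiveFactorRestrictedGaussian` — spine estimate NE7c (node U5b), road (δ) THRESHOLD
# RANDOMISATION: the (L1-step) robustness census's class C8 (a threshold-RESTRICTED Gaussian normalisation is bounded
# FROM BELOW, [B16] pp. 357–358 ∕ p. 380) IN KERNEL FORM — shrinking the restriction box by the live factor
# `λ ∈ (0, 1]` costs at most the factor `λ^{dim}` = `exp(−dim·log λ⁻¹)`, i.e. a constant of print's own form
# `exp(−O(1)|Λ|)` (cell `pub-balaban-gaps`, track G2, seat ne8 gen 2; record `HOME/ne/NE7c.md` §7 rows 19 ∕ 29)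

HONEST FRAMING.  Finite four-torus programme, rung (B)+1 only — NOT infinite volume, NOT a mass gap, NOT the Clay
problem, NOT summit progress, NOT a proof of NE7c (`T4IndicatorShell.ShellWeightBound`, INSTANCE 0∕1, which waits on
node O).  Nothing of [Bałaban 1983–89] is asserted: the printed sentences are quoted below only to say which READING
this leaf serves; what is PROVED is a [folklore] change-of-variables inequality for additive Haar measure on a
finite-dimensional real vector space (Mathlib `Measure.map_addHaar_smul`).  This file does NOT verify that C1 ∕ C8 are
the census's only lower-bound uses of a live threshold (the completeness of the (L1-step) census over [B14]–[B16] is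
NOT PRINTED, GAPS G-ne7cp1-2; the cell's two-reader census is `HOME/ne/NE7c.md` §7).  Spine PROVED 0∕9 — unchanged.

THE PRINTED LOCI (as quoted in the census; T. Bałaban, CMP **122** (1989) 355–392 = [B16]).  p. 356 (1.2) puts the
characteristic function «χ({|B′| < M₀g_k⁻¹δ_k})» into the 𝐑-operation's DENOMINATOR integral, and pp. 357–358
(1.6)–(1.11) bound that restricted Gaussian integral FROM BELOW: «bounded from below by exp(−O(1)|Λ|) = exp(−O(M⁴))»;
p. 380 l. 14–17: the normalisation constants contribute «O(1) log g_j⁻² |Z_j|» per large-field domain.  Under road (δ)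
(member (δ-1) of `Literature.…T4ShellMeasure` §8e) a LIVE fluctuation threshold `θ = M₀g_k⁻¹δ_k` becomes `λθ`,
`λ ∈ [λ₀, 1]`, so the restriction box SHRINKS: an upper bound on a restricted integral only improves (class C3), and a
LOWER bound loses at most the Jacobian `λ^{dim}` because a centred Gaussian weight does not decrease along rays towards
the origin — the content of this file.  With `dim = (components per bond)·|Λ|` and `λ ≥ λ₀`, `λ^{dim} ≥
exp(−(k log λ₀⁻¹)|Λ|)`: print's «exp(−O(1)|Λ|)» with `O(1) ↦ O(1) + k log λ₀⁻¹` — census class C8, MILD, absorbed like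
print's own constant by that component's `exp(−p₀(g))` (census row 26).

WHAT IS HERE (all PROVED, [folklore]).
* §1 `lintegral_comp_smul_haar` — `∫⁻ G(c·x) dμ = |c^{−dim}| ∫⁻ G dμ` for an additive Haar measure `μ` (adapted from the
  tree's `Literature/Analysis/FluidPDE/PoincareBall.lean`, `lintegral_comp_smul_add`, to a general `μ`).
* §2 `setLIntegral_smul_set_ge` — for `f : E → ℝ≥0∞` NON-INCREASING ALONG RAYS at ratio `t` (`f x ≤ f (t • x)` for all
  `x`, `0 < t`) and a measurable `S`: `t^{dim} · ∫⁻_S f ≤ ∫⁻_{t•S} f`.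
* §3 `gaussian_ray_mono` — a weight `exp(−Q)` with `Q(t•x) = t²Q(x)`, `Q ≥ 0`, `0 ≤ t ≤ 1` is non-increasing along
  rays; `setLIntegral_gaussian_smul_set_ge` — §2 for such weights.
* §4 the box reading: the restriction box `{x : ι → ℝ | ∀ i, |x i| < θ}` is measurable (`measurableSet_box`), the
  box at `tθ` is `t •` the box at `θ` (`box_smul`), `dim = #ι` (`Module.finrank_fintype_fun_eq_card`), and the HEADLINE
  `restrictedGaussian_lower_live`: a printed-form lower bound `exp(−C) ≤ ∫⁻_{box θ} exp(−Q)` implies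
  `exp(−(C + #ι·log t⁻¹)) ≤ ∫⁻_{box (tθ)} exp(−Q)` for every `0 < t ≤ 1`.
* §5 the TAIL form for PROBABILITY masses (the volume-uniform use, [B14] (3.27) ∕ (3.32)'s `(∫dμ χ_t^{(k)})⁻¹`, where
  the Jacobian form would be extensive): `restrictedMass_union_bound` (`1 ≤ P{∀ b, |X_b| < s} + Σ_b P{s ≤ |X_b|}`),
  `tail_sum_le_of_clause` (n Gaussian tails at the lowered threshold `λθ` are `≤ exp(−target)` once
  `log(2n) + target ≤ λ₀²θ²∕(2v)` — census class C1, the clause asked once at `λ₀`), `restrictedMass_lower_live`.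
* §6 (L2b)'s kernel core: `prod_decomposition_of_unity`, `lintegral_decomposition_of_unity` — inserting decompositions
  of unity at any thresholds leaves the total integral unchanged ([B15] p. 193 «equal integrals»).
NOT HERE: which integrals of (1.6)–(1.11) ∕ (3.27) are meant (node O's junction), the value of print's O(1), the
Gaussian tail bound itself (a hypothesis `htail`), class C1 at the large-field factors (the sibling
`…Spine.NE7c.LiveFactorLargeField`).  0 `def`, 0 sorry.
-/

namespace Summit.QuantumFields.BalabanUV.T4Continuum.Spine.NE7c.LiveFactorRestrictedGaussian

open MeasureTheory MeasureTheory.Measure Module Set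
open scoped ENNReal Pointwise

noncomputable section

variable {E : Type*} [NormedAddCommGroup E] [NormedSpace ℝ E] [MeasurableSpace E] [BorelSpace E]
  [FiniteDimensional ℝ E] (μ : Measure E) [IsAddHaarMeasure μ]

/-! ## §1. Homotheties and additive Haar measure -/

/-- `∫⁻ G(c·x) dμ(x) = |c^{−dim E}| · ∫⁻ G dμ` for `c ≠ 0` and an additive Haar measure `μ` on a finite-dimensional real
normed space (Mathlib `Measure.map_addHaar_smul` + `lintegral_map_equiv`).
-- adapted from Literature/Analysis/FluidPDE/PoincareBall.lean (`lintegral_comp_smul_add`, `volume` version)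
[folklore] -/
theorem lintegral_comp_smul_haar (G : E → ℝ≥0∞) {c : ℝ} (hc : c ≠ 0) :
    ∫⁻ x, G (c • x) ∂μ = ENNReal.ofReal |(c ^ finrank ℝ E)⁻¹| * ∫⁻ y, G y ∂μ := by
  calc ∫⁻ x, G (c • x) ∂μ = ∫⁻ y, G y ∂(Measure.map (fun x : E => c • x) μ) :=
        (lintegral_map_equiv G
          (Homeomorph.smul (isUnit_iff_ne_zero.2 hc).unit).toMeasurableEquiv).symm
    _ = ENNReal.ofReal |(c ^ finrank ℝ E)⁻¹| * ∫⁻ y, G y ∂μ := by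
        rw [Measure.map_addHaar_smul μ hc, lintegral_smul_measure, smul_eq_mul]

/-! ## §2. Shrinking the domain of a ray-monotone weight costs at most the Jacobian -/

/-- **Shrinking lemma.**  If `f : E → ℝ≥0∞` does not decrease along rays towards the origin at ratio `t > 0`
(`f x ≤ f (t • x)` for every `x`; for `t ≤ 1` this says `f` is radially non-increasing at that ratio) and `S` is
measurable, then `t^{dim E} · ∫⁻_S f dμ ≤ ∫⁻_{t • S} f dμ`: substituting `x = t·y` in the right-hand side produces the
Jacobian `t^{dim}` and the integrand `f(t·y) ≥ f(y)` on `S`. [folklore] -/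
theorem setLIntegral_smul_set_ge {f : E → ℝ≥0∞} {t : ℝ} (ht : 0 < t) (hmono : ∀ x, f x ≤ f (t • x)) {S : Set E}
    (hS : MeasurableSet S) :
    ENNReal.ofReal (t ^ finrank ℝ E) * ∫⁻ x in S, f x ∂μ ≤ ∫⁻ x in t • S, f x ∂μ := by
  have ht0 : t ≠ 0 := ht.ne'
  have htS : MeasurableSet (t • S) := hS.const_smul_of_ne_zero ht0
  rw [← lintegral_indicator hS, ← lintegral_indicator htS]
  -- pointwise on the substituted integrand: `1_S(y) f(y) ≤ 1_{tS}(t y) f(t y)`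
  have hpt : ∀ y, S.indicator f y ≤ (t • S).indicator f (t • y) := by
    intro y
    by_cases hy : y ∈ S
    · rw [indicator_of_mem hy, indicator_of_mem ((smul_mem_smul_set_iff₀ ht0 S y).2 hy)]
      exact hmono y
    · rw [indicator_of_notMem hy]
      exact zero_le
  have hsub : ∫⁻ y, (t • S).indicator f (t • y) ∂μ =
      ENNReal.ofReal |(t ^ finrank ℝ E)⁻¹| * ∫⁻ x, (t • S).indicator f x ∂μ :=
    lintegral_comp_smul_haar μ ((t • S).indicator f) ht0
  have htn : 0 < t ^ finrank ℝ E := pow_pos ht _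
  have hone : ENNReal.ofReal (t ^ finrank ℝ E) * ENNReal.ofReal |(t ^ finrank ℝ E)⁻¹| = 1 := by
    rw [abs_of_pos (inv_pos.2 htn), ← ENNReal.ofReal_mul htn.le, mul_inv_cancel₀ htn.ne', ENNReal.ofReal_one]
  calc ENNReal.ofReal (t ^ finrank ℝ E) * ∫⁻ y, S.indicator f y ∂μ
      ≤ ENNReal.ofReal (t ^ finrank ℝ E) * ∫⁻ y, (t • S).indicator f (t • y) ∂μ := by
        gcongr with y
        exact hpt y
    _ = (ENNReal.ofReal (t ^ finrank ℝ E) * ENNReal.ofReal |(t ^ finrank ℝ E)⁻¹|) *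
          ∫⁻ x, (t • S).indicator f x ∂μ := by rw [hsub, mul_assoc]
    _ = ∫⁻ x, (t • S).indicator f x ∂μ := by rw [hone, one_mul]

/-! ## §3. Centred Gaussian weights are ray-monotone -/

omit [MeasurableSpace E] [BorelSpace E] [FiniteDimensional ℝ E] in
/-- A weight `exp(−Q)` whose exponent is homogeneous of degree two along the ray (`Q(t·x) = t²Q(x)`) and non-negative
is radially non-increasing: `exp(−Q x) ≤ exp(−Q (t·x))` for `0 ≤ t ≤ 1` (print, p. 383: *"we estimate the quadratic
form in B from below by 0"* — the forms restricted by the characteristic functions are positive). [folklore] -/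
theorem gaussian_ray_mono {Q : E → ℝ} {t : ℝ} (ht0 : 0 ≤ t) (ht1 : t ≤ 1) (hQ2 : ∀ x, Q (t • x) = t ^ 2 * Q x)
    (hQ0 : ∀ x, 0 ≤ Q x) (x : E) :
    ENNReal.ofReal (Real.exp (-Q x)) ≤ ENNReal.ofReal (Real.exp (-Q (t • x))) := by
  refine ENNReal.ofReal_le_ofReal (Real.exp_le_exp.2 (neg_le_neg ?_))
  rw [hQ2 x]
  have ht2 : t ^ 2 ≤ 1 := pow_le_one₀ ht0 ht1
  nlinarith [hQ0 x]

/-- §2 for centred Gaussian weights: `t^{dim}·∫⁻_S e^{−Q} ≤ ∫⁻_{t•S} e^{−Q}` for `0 < t ≤ 1`, `Q(t·x) = t²Q(x) ≥ 0`,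
`S` measurable. [folklore] -/
theorem setLIntegral_gaussian_smul_set_ge {Q : E → ℝ} {t : ℝ} (ht : 0 < t) (ht1 : t ≤ 1)
    (hQ2 : ∀ x, Q (t • x) = t ^ 2 * Q x) (hQ0 : ∀ x, 0 ≤ Q x) {S : Set E} (hS : MeasurableSet S) :
    ENNReal.ofReal (t ^ finrank ℝ E) * ∫⁻ x in S, ENNReal.ofReal (Real.exp (-Q x)) ∂μ ≤
      ∫⁻ x in t • S, ENNReal.ofReal (Real.exp (-Q x)) ∂μ :=
  setLIntegral_smul_set_ge μ ht (gaussian_ray_mono ht.le ht1 hQ2 hQ0) hS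

/-! ## §4. The box reading of (1.2)'s restriction and the headline -/

/-- The restriction box `{x | ∀ i, |x i| < θ}` of a small-field characteristic function on finitely many real
variables (print's «χ({|B′| < M₀g_k⁻¹δ_k})», one real component per index) is measurable (a finite intersection of
preimages of open intervals under the coordinate maps). [folklore] -/
theorem measurableSet_box (ι : Type*) [Fintype ι] (θ : ℝ) : MeasurableSet {x : ι → ℝ | ∀ i, |x i| < θ} := by
  have : {x : ι → ℝ | ∀ i, |x i| < θ} = ⋂ i, (fun x : ι → ℝ => x i) ⁻¹' (Ioo (-θ) θ) := by
    ext x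
    simp only [mem_setOf_eq, mem_iInter, mem_preimage, mem_Ioo, abs_lt]
  rw [this]
  exact MeasurableSet.iInter fun i => measurableSet_Ioo.preimage (measurable_pi_apply i)

/-- Lowering the threshold by `t > 0` IS the homothety of the box: `{|x i| < tθ ∀ i} = t • {|x i| < θ ∀ i}`. [folklore] -/
theorem box_smul (ι : Type*) {t : ℝ} (ht : 0 < t) (θ : ℝ) :
    {x : ι → ℝ | ∀ i, |x i| < t * θ} = t • {x : ι → ℝ | ∀ i, |x i| < θ} := by
  ext x
  rw [mem_smul_set_iff_inv_smul_mem₀ ht.ne']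
  simp only [mem_setOf_eq, Pi.smul_apply, smul_eq_mul, abs_mul, abs_inv, abs_of_pos ht]
  refine forall_congr' fun i => ?_
  rw [inv_mul_lt_iff₀ ht]

/-- The Jacobian as an exponential of the dimension: `t^{#ι} = exp(−#ι·log t⁻¹)` for `t > 0` — the form in which the
shrinking cost joins print's «exp(−O(1)|Λ|)». [folklore] -/
theorem pow_card_eq_exp (ι : Type*) [Fintype ι] {t : ℝ} (ht : 0 < t) :
    t ^ Fintype.card ι = Real.exp (-(Fintype.card ι * Real.log t⁻¹)) := by
  rw [Real.log_inv, mul_neg, neg_neg, ← Real.log_pow, Real.exp_log (pow_pos ht _)]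

/-- **HEADLINE — census class C8 in kernel form.**  On the variables `ι → ℝ` of one restriction (additive Haar measure
`μ`, e.g. Lebesgue), let the Gaussian exponent satisfy `Q(t·x) = t²Q(x) ≥ 0`.  If the θ-restricted normalisation obeys
a printed-form lower bound `exp(−C) ≤ ∫⁻_{box θ} e^{−Q} dμ` ([B16] p. 358: «bounded from below by exp(−O(1)|Λ|)»), then
after lowering the threshold by ANY live factor `0 < t ≤ 1` the same holds with `C ↦ C + #ι·log t⁻¹`:
`exp(−(C + #ι log t⁻¹)) ≤ ∫⁻_{box (tθ)} e^{−Q} dμ`.  For `t ≥ λ₀` and `#ι = k|Λ|` this is print's bound with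
`O(1) ↦ O(1) + k log λ₀⁻¹` — a constant depending on the slack `λ₀ = 1 − β′` only. [folklore] -/
theorem restrictedGaussian_lower_live {ι : Type*} [Fintype ι] (ν : Measure (ι → ℝ)) [IsAddHaarMeasure ν]
    {Q : (ι → ℝ) → ℝ} {t θ C : ℝ} (ht : 0 < t) (ht1 : t ≤ 1) (hQ2 : ∀ x, Q (t • x) = t ^ 2 * Q x)
    (hQ0 : ∀ x, 0 ≤ Q x)
    (hlow : ENNReal.ofReal (Real.exp (-C)) ≤
      ∫⁻ x in {x : ι → ℝ | ∀ i, |x i| < θ}, ENNReal.ofReal (Real.exp (-Q x)) ∂ν) :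
    ENNReal.ofReal (Real.exp (-(C + Fintype.card ι * Real.log t⁻¹))) ≤
      ∫⁻ x in {x : ι → ℝ | ∀ i, |x i| < t * θ}, ENNReal.ofReal (Real.exp (-Q x)) ∂ν := by
  have hmain := setLIntegral_gaussian_smul_set_ge ν ht ht1 hQ2 hQ0 (measurableSet_box ι θ)
  rw [box_smul ι ht θ]
  refine le_trans ?_ hmain
  calc ENNReal.ofReal (Real.exp (-(C + Fintype.card ι * Real.log t⁻¹)))
      = ENNReal.ofReal (t ^ Fintype.card ι) * ENNReal.ofReal (Real.exp (-C)) := by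
        rw [pow_card_eq_exp ι ht, ← ENNReal.ofReal_mul (Real.exp_pos _).le, ← Real.exp_add]
        congr 1
        ring_nf
    _ ≤ ENNReal.ofReal (t ^ Fintype.card ι) *
          ∫⁻ x in {x : ι → ℝ | ∀ i, |x i| < θ}, ENNReal.ofReal (Real.exp (-Q x)) ∂ν := by
        gcongr
    _ = ENNReal.ofReal (t ^ finrank ℝ (ι → ℝ)) *
          ∫⁻ x in {x : ι → ℝ | ∀ i, |x i| < θ}, ENNReal.ofReal (Real.exp (-Q x)) ∂ν := by
        rw [finrank_fintype_fun_eq_card]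

/-! ## §5. The TAIL form: a restricted PROBABILITY mass loses only Gaussian tails (the volume-uniform use) -/

/-- **Union bound for a restricted mass.**  For a probability measure `P`, finitely many real observables `X_b`
(`b ∈ B`, measurable) and a threshold `s`: `1 ≤ P{∀ b ∈ B, |X_b| < s} + Σ_{b∈B} P{s ≤ |X_b|}` — the mass of the
small-field set is at least one minus the sum of the single-variable tails.  This is the form in which a
threshold-restricted normalisation is bounded from below PER CUBE (volume-uniformly), e.g. the χ^{(k)}-restricted
probabilistic measures of [B14] (3.27) and the factor `(∫dμ χ_t^{(k)})⁻¹` of (3.32): there the Jacobian form of §2 would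
cost `λ^{#variables}` — extensive —, whereas the tail form costs only Gaussian tails whose exponents carry the live
factor as `λ²` (census class C1, absorbed by `tail_sum_le_of_clause`). [folklore] -/
theorem restrictedMass_union_bound {Ω : Type*} [MeasurableSpace Ω] (P : Measure Ω) [IsProbabilityMeasure P]
    {ι : Type*} (B : Finset ι) (X : ι → Ω → ℝ) (hX : ∀ b ∈ B, Measurable (X b)) (s : ℝ) :
    1 ≤ P {ω | ∀ b ∈ B, |X b ω| < s} + ∑ b ∈ B, P {ω | s ≤ |X b ω|} := by
  set S : Set Ω := {ω | ∀ b ∈ B, |X b ω| < s} with hSdef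
  have hS : MeasurableSet S := by
    have : S = ⋂ b ∈ B, {ω | |X b ω| < s} := by
      ext ω
      simp only [hSdef, mem_setOf_eq, mem_iInter]
    rw [this]
    exact MeasurableSet.biInter B.countable_toSet fun b hb =>
      measurableSet_lt (hX b hb).abs measurable_const
  have hcompl : Sᶜ ⊆ ⋃ b ∈ B, {ω | s ≤ |X b ω|} := by
    intro ω hω
    simp only [hSdef, mem_compl_iff, mem_setOf_eq, not_forall, not_lt] at hω
    obtain ⟨b, hb, hle⟩ := hω
    simp only [mem_iUnion, mem_setOf_eq]
    exact ⟨b, hb, hle⟩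
  have h1 : P Sᶜ ≤ ∑ b ∈ B, P {ω | s ≤ |X b ω|} :=
    (measure_mono hcompl).trans (measure_biUnion_finset_le B _)
  calc (1 : ℝ≥0∞) = P univ := measure_univ.symm
    _ = P S + P Sᶜ := (measure_add_measure_compl hS).symm
    _ ≤ P S + ∑ b ∈ B, P {ω | s ≤ |X b ω|} := by gcongr

/-- **Absorption of the tails (census class C1, tail form).**  If each of `n` variables has the (sub-)Gaussian tail
`2·exp(−(λθ)²∕(2v))` beyond the LOWERED threshold `λθ` (`λ ≥ λ₀ > 0`, `θ` the printed threshold in units where the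
covariance scale is `v > 0`), then the total tail is at most any prescribed `exp(−target)` as soon as the clause
`log(2n) + target ≤ λ₀²θ²∕(2v)` holds — asked ONCE at `λ₀`; in print's letters `θ²∕v ∝ (A₁∕A₀)²p₀²(g_k)` grows faster
than `target = p₀(g_k)`, so the clause is «g_k sufficiently small» depending on `λ₀`. [folklore] -/
theorem tail_sum_le_of_clause {n : ℕ} {v θ lam lam₀ target : ℝ} (hv : 0 < v) (h0 : 0 < lam₀) (hμ : lam₀ ≤ lam)
    (hclause : Real.log (2 * n) + target ≤ lam₀ ^ 2 * θ ^ 2 / (2 * v)) :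
    (n : ℝ) * (2 * Real.exp (-((lam * θ) ^ 2 / (2 * v)))) ≤ Real.exp (-target) := by
  rcases Nat.eq_zero_or_pos n with hn | hn
  · subst hn
    simp only [Nat.cast_zero, zero_mul]
    exact (Real.exp_pos _).le
  have hn' : (0 : ℝ) < 2 * n := by positivity
  -- lower the live factor to `λ₀` inside the exponent
  have hsq : lam₀ ^ 2 * θ ^ 2 ≤ (lam * θ) ^ 2 := by
    rw [mul_pow]
    exact mul_le_mul_of_nonneg_right (pow_le_pow_left₀ h0.le hμ 2) (sq_nonneg θ)
  have hexp : Real.exp (-((lam * θ) ^ 2 / (2 * v))) ≤ Real.exp (-(Real.log (2 * n) + target)) := by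
    refine Real.exp_le_exp.2 (neg_le_neg (hclause.trans ?_))
    exact div_le_div_of_nonneg_right hsq (by positivity)
  calc (n : ℝ) * (2 * Real.exp (-((lam * θ) ^ 2 / (2 * v))))
      = (2 * n) * Real.exp (-((lam * θ) ^ 2 / (2 * v))) := by ring
    _ ≤ (2 * n) * Real.exp (-(Real.log (2 * n) + target)) := mul_le_mul_of_nonneg_left hexp hn'.le
    _ = Real.exp (-target) := by
        rw [neg_add, Real.exp_add, Real.exp_neg, Real.exp_log hn', ← mul_assoc, mul_inv_cancel₀ hn'.ne', one_mul]

/-- The two lemmas together: a per-cube lower bound `P{∀ b, |X_b| < λθ} ≥ 1 − exp(−target)` for every live factor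
`λ ≥ λ₀`, from single-variable tails at the lowered threshold and the clause at `λ₀`. [folklore] -/
theorem restrictedMass_lower_live {Ω : Type*} [MeasurableSpace Ω] (P : Measure Ω) [IsProbabilityMeasure P]
    {ι : Type*} (B : Finset ι) (X : ι → Ω → ℝ) (hX : ∀ b ∈ B, Measurable (X b))
    {v θ lam lam₀ target : ℝ} (hv : 0 < v) (h0 : 0 < lam₀) (hμ : lam₀ ≤ lam)
    (htail : ∀ b ∈ B, P {ω | lam * θ ≤ |X b ω|} ≤ ENNReal.ofReal (2 * Real.exp (-((lam * θ) ^ 2 / (2 * v)))))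
    (hclause : Real.log (2 * B.card) + target ≤ lam₀ ^ 2 * θ ^ 2 / (2 * v)) :
    1 ≤ P {ω | ∀ b ∈ B, |X b ω| < lam * θ} + ENNReal.ofReal (Real.exp (-target)) := by
  have h1 := restrictedMass_union_bound P B X hX (lam * θ)
  have h2 : ∑ b ∈ B, P {ω | lam * θ ≤ |X b ω|} ≤ ENNReal.ofReal (Real.exp (-target)) := by
    calc ∑ b ∈ B, P {ω | lam * θ ≤ |X b ω|}
        ≤ ∑ b ∈ B, ENNReal.ofReal (2 * Real.exp (-((lam * θ) ^ 2 / (2 * v)))) := Finset.sum_le_sum htail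
      _ = ENNReal.ofReal (B.card * (2 * Real.exp (-((lam * θ) ^ 2 / (2 * v))))) := by
          rw [Finset.sum_const, nsmul_eq_mul, ENNReal.ofReal_mul (Nat.cast_nonneg _), ENNReal.ofReal_natCast]
      _ ≤ ENNReal.ofReal (Real.exp (-target)) :=
          ENNReal.ofReal_le_ofReal (tail_sum_le_of_clause hv h0 hμ hclause)
  calc (1 : ℝ≥0∞) ≤ P {ω | ∀ b ∈ B, |X b ω| < lam * θ} + ∑ b ∈ B, P {ω | lam * θ ≤ |X b ω|} := h1
    _ ≤ P {ω | ∀ b ∈ B, |X b ω| < lam * θ} + ENNReal.ofReal (Real.exp (-target)) := by gcongr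

/-! ## §6. (L2b): decompositions of unity at ANY thresholds leave the integral unchanged -/

/-- The located input (L2b) of road (δ) ([B15] p. 193: *"All the above transformations preserve the kth density … the
equivalence means that both sides have equal integrals over the space of fields V_k"*; `T4ShellMeasureSocket` §3's
`∀ i` dictionary binders) in its kernel core: a product of decompositions of unity `1 = χ_{S_i} + χ_{S_iᶜ}` is
identically `1`, WHATEVER the sets `S_i` (in particular whatever thresholds define them) … [folklore] -/
theorem prod_decomposition_of_unity {Ω ι : Type*} (B : Finset ι) (S : ι → Set Ω) (ω : Ω) :
    ∏ i ∈ B, ((S i).indicator (fun _ => (1 : ℝ≥0∞)) ω + (S i)ᶜ.indicator (fun _ => (1 : ℝ≥0∞)) ω) = 1 := by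
  refine Finset.prod_eq_one fun i _ => ?_
  by_cases h : ω ∈ S i
  · rw [indicator_of_mem h, indicator_of_notMem (fun hc => (mem_compl_iff _ _).1 hc h), add_zero]
  · rw [indicator_of_notMem h, indicator_of_mem (mem_compl h), zero_add]

/-- … hence the total integral of a density against which the `2^{#B}`-term expansion is generated does not depend on
the candidate threshold assignment: `∫⁻ (∏_i (χ_{S_i} + χ_{S_iᶜ}))·f dP = ∫⁻ f dP` for every family `S`. This is why
the pigeonhole of `T4ShellMeasure.exists_threshold_choice_function` may choose the live thresholds AFTER the partition
functions are fixed. [folklore] -/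
theorem lintegral_decomposition_of_unity {Ω ι : Type*} [MeasurableSpace Ω] (P : Measure Ω) (B : Finset ι)
    (S : ι → Set Ω) (f : Ω → ℝ≥0∞) :
    ∫⁻ ω, (∏ i ∈ B, ((S i).indicator (fun _ => (1 : ℝ≥0∞)) ω + (S i)ᶜ.indicator (fun _ => (1 : ℝ≥0∞)) ω)) * f ω ∂P =
      ∫⁻ ω, f ω ∂P := by
  simp_rw [prod_decomposition_of_unity, one_mul]

/-- SANITY (the hypotheses of the headline are jointly satisfiable by non-degenerate data): one real variable, the
standard Gaussian exponent `Q x = (x 0)²` is homogeneous of degree two and non-negative. [folklore] -/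
example (t : ℝ) (x : Fin 1 → ℝ) : (fun y : Fin 1 → ℝ => (y 0) ^ 2) (t • x) = t ^ 2 * (x 0) ^ 2 ∧ 0 ≤ (x 0) ^ 2 := by
  refine ⟨?_, sq_nonneg _⟩
  simp only [Pi.smul_apply, smul_eq_mul]
  ring

end

end Summit.QuantumFields.BalabanUV.T4Continuum.Spine.NE7c.LiveFactorRestrictedGaussian
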